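import Summits.Ventures.PercRepro.ProfileFlatUpsetHyperplane

/-!
# PercRepro — (G) AT EVERY PRINCIPAL UP-SET OF A FLAT OF CORANK TWO ON `2r − 2` POINTS (a kernel theorem by double counting)
(p10, gen 19; `proofs/P10-AVFULL.md` §27)

`M` of rank `r` on `N = 2r − 2` points, `F₀` a flat of rank `r − 2`: a separated set of `principalUp M F₀` has
`#Z ∈ {r − 1, r}` (`card_of_mem_sepSets_corank_two`), so the term `2 #Z − N − 1` is `−1` on `negTwo` and `+1` on
`posTwo`.  THEOREM `sum_sepSets_principal_corank_two_nonneg`: `#negTwo ≤ #posTwo`, by DOUBLE COUNTING `Z ⊆ B`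
(`Finset.card_mul_le_card_mul`): a negative `Z` lies below `#(E ∖ cl Z) ≥ 1` positive sets (`insert x Z`, `x ∉ cl Z`);
a positive `B` lies above at most two — two erasures `x₁ ≠ x₂` with `F₀ ⊆ cl (B ∖ x_i)` force `B ∖ {x₁, x₂} ⊆ F₀`
(`mem_of_two_erase`) and a third would lie in its own closure.  No coloop outside `F₀`: `#(E ∖ cl Z) ≥ 2` and
`2 #negTwo ≤ 2 #posTwo`; a coloop `y ∉ F₀`: at most ONE negative set below each positive `B`
(`card_bipartiteBelow_le_one_of_coloop`).  Outside the `p`-girth regime of gen 16 (it needs `rk F₀ = r − 1` here):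
the first kernel instance of (G) with negative terms beyond the hyperplanes.  Nothing here asserts (G) in general.
-/

open scoped Matroid

namespace PercRepro.Cogirth

open Finset ThmH Skew

variable {α : Type} [DecidableEq α] {M : Matroid α} [M.Finite]

/-! ### The two sizes of a separated set -/

/-- The closure of a set containing `F₀` is in the principal up-set. -/
theorem clF_mem_principalUp_of_subset {F₀ X : Finset α} (h : F₀ ⊆ clF M X) : clF M X ∈ principalUp M F₀ := by
  rw [mem_principalUp]
  exact ⟨clF_subset_gr_fu _, isFlatF_clF _, h⟩

/-- For a separated set of a principal up-set, `F₀ ⊆ cl Z` and `F₀ ⊄ cl (E ∖ Z)`. -/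
theorem subset_clF_of_mem_sepSets_principal {F₀ Z : Finset α} (hZ : Z ∈ sepSets M (principalUp M F₀)) :
    F₀ ⊆ clF M Z ∧ ¬ F₀ ⊆ clF M (gr M \ Z) := by
  rw [mem_sepSets] at hZ
  obtain ⟨_, hin, hout⟩ := hZ
  rw [mem_principalUp] at hin
  exact ⟨hin.2.2, fun h => hout (clF_mem_principalUp_of_subset h)⟩

/-- In the corank-two regime (`rk F₀ + 2 = r`, `N + 2 = 2r`) a separated set has `#Z = r − 1` or `#Z = r`,
and `#Z + #(E ∖ Z) = N`. -/
theorem card_of_mem_sepSets_corank_two {F₀ : Finset α} (hF : IsFlatF M F₀) (hr : rk M F₀ + 2 = rk M (gr M))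
    (hN : (gr M).card + 2 = 2 * rk M (gr M)) {Z : Finset α} (hZ : Z ∈ sepSets M (principalUp M F₀)) :
    (Z.card + 1 = rk M (gr M) ∨ Z.card = rk M (gr M)) ∧ Z.card + (gr M \ Z).card = (gr M).card := by
  obtain ⟨hin, hout⟩ := subset_clF_of_mem_sepSets_principal hZ
  rw [mem_sepSets, mem_biIndepAll] at hZ
  obtain ⟨⟨hZg, hZr, hZc⟩, _, _⟩ := hZ
  have hsum : Z.card + (gr M \ Z).card = (gr M).card := by
    rw [card_sdiff_of_subset hZg]; have := card_le_card hZg; omega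
  refine ⟨?_, hsum⟩
  have h1 : rk M F₀ ≤ Z.card := by have := rk_mono_fu (M := M) hin; rwa [rk_clF_eq_fu, hZr] at this
  have h2 : Z.card ≤ rk M (gr M) := by have := rk_mono_fu (M := M) hZg; rwa [hZr] at this
  have h3 : (gr M \ Z).card + 1 ≤ rk M (gr M) := by
    by_contra hcon
    have hle : rk M (gr M \ Z) ≤ rk M (gr M) := rk_mono_fu sdiff_subset
    have heq : rk M (gr M \ Z) = rk M (gr M) := by omega
    apply hout
    rw [clF_eq_gr_of_rk_eq sdiff_subset heq]
    exact hF.1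
  omega

/-- The negative terms of the corank-two regime: `#Z + 1 = r`. -/
noncomputable def negTwo (M : Matroid α) [M.Finite] (F₀ : Finset α) : Finset (Finset α) :=
  (sepSets M (principalUp M F₀)).filter (fun Z => Z.card + 1 = rk M (gr M))

/-- The positive terms of the corank-two regime: `#Z = r`. -/
noncomputable def posTwo (M : Matroid α) [M.Finite] (F₀ : Finset α) : Finset (Finset α) :=
  (sepSets M (principalUp M F₀)).filter (fun Z => Z.card = rk M (gr M))

/-- Membership in `negTwo`. -/
theorem mem_negTwo {F₀ Z : Finset α} :
    Z ∈ negTwo M F₀ ↔ Z ∈ sepSets M (principalUp M F₀) ∧ Z.card + 1 = rk M (gr M) := by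
  unfold negTwo
  rw [mem_filter]

/-- Membership in `posTwo`. -/
theorem mem_posTwo {F₀ Z : Finset α} :
    Z ∈ posTwo M F₀ ↔ Z ∈ sepSets M (principalUp M F₀) ∧ Z.card = rk M (gr M) := by
  unfold posTwo
  rw [mem_filter]

/-- Every term of the signed sum is `[Z ∈ posTwo] − [Z ∈ negTwo]`. -/
theorem term_eq_of_mem_sepSets_corank_two {F₀ : Finset α} (hF : IsFlatF M F₀) (hr : rk M F₀ + 2 = rk M (gr M))
    (hN : (gr M).card + 2 = 2 * rk M (gr M)) {Z : Finset α} (hZ : Z ∈ sepSets M (principalUp M F₀)) :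
    2 * (Z.card : ℤ) - (gr M).card - 1 =
      (if Z ∈ posTwo M F₀ then 1 else 0 : ℤ) - (if Z ∈ negTwo M F₀ then 1 else 0) := by
  obtain ⟨hcases, _⟩ := card_of_mem_sepSets_corank_two hF hr hN hZ
  have hN' : ((gr M).card : ℤ) + 2 = 2 * rk M (gr M) := by exact_mod_cast hN
  rcases hcases with h | h
  · have hn : Z ∈ negTwo M F₀ := mem_negTwo.2 ⟨hZ, h⟩
    have hp : Z ∉ posTwo M F₀ := fun hp => by have := (mem_posTwo.1 hp).2; omega
    rw [if_neg hp, if_pos hn]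
    have h' : (Z.card : ℤ) + 1 = rk M (gr M) := by exact_mod_cast h
    linarith
  · have hp : Z ∈ posTwo M F₀ := mem_posTwo.2 ⟨hZ, h⟩
    have hn : Z ∉ negTwo M F₀ := fun hn => by have := (mem_negTwo.1 hn).2; omega
    rw [if_pos hp, if_neg hn]
    have h' : (Z.card : ℤ) = rk M (gr M) := by exact_mod_cast h
    linarith

/-! ### The lower degree: a negative set lies below `#(E ∖ cl Z)` positive sets -/

/-- Adding a point outside the closure of a negative set gives a positive set. -/
theorem insert_mem_posTwo {F₀ Z : Finset α} (hZ : Z ∈ negTwo M F₀) {x : α} (hx : x ∈ gr M)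
    (hxcl : x ∉ clF M Z) : insert x Z ∈ posTwo M F₀ := by
  rw [mem_negTwo] at hZ
  obtain ⟨hZs, hc⟩ := hZ
  obtain ⟨hin, hout⟩ := subset_clF_of_mem_sepSets_principal hZs
  have hZb : Z ∈ biIndepAll M := (mem_sepSets.1 hZs).1
  have hZg : Z ⊆ gr M := (mem_biIndepAll.1 hZb).1
  have hxZ : x ∉ Z := fun h => hxcl (subset_clF_fu hZg h)
  rw [mem_posTwo, mem_sepSets]
  refine ⟨⟨(insert_mem_biIndepAll_iff hZb hx hxZ).2 hxcl, ?_, ?_⟩, by rw [card_insert_of_notMem hxZ]; exact hc⟩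
  · exact clF_mem_principalUp_of_subset (hin.trans (clF_mono_fu (subset_insert x Z)))
  · intro hcon
    rw [mem_principalUp] at hcon
    apply hout
    refine hcon.2.2.trans (clF_mono_fu ?_)
    exact sdiff_subset_sdiff (Subset.refl _) (subset_insert x Z)

/-- A negative set lies below at least `#(E ∖ cl Z)` positive sets. -/
theorem card_sdiff_clF_le_card_bipartiteAbove {F₀ Z : Finset α} (hZ : Z ∈ negTwo M F₀) :
    (gr M \ clF M Z).card ≤ ((posTwo M F₀).bipartiteAbove (fun (Z B : Finset α) => Z ⊆ B) Z).card := by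
  have hZg : Z ⊆ gr M := (mem_biIndepAll.1 (mem_sepSets.1 (mem_negTwo.1 hZ).1).1).1
  apply card_le_card_of_injOn (fun x => insert x Z)
  · intro x hx
    rw [mem_coe, mem_sdiff] at hx
    rw [mem_coe, mem_bipartiteAbove]
    exact ⟨insert_mem_posTwo hZ hx.1 hx.2, subset_insert x Z⟩
  · intro x hx y hy heq
    rw [mem_coe, mem_sdiff] at hx hy
    have hxZ : x ∉ Z := fun h => hx.2 (subset_clF_fu hZg h)
    have heq' : insert x Z = insert y Z := heq
    have hx' : x ∈ insert y Z := by rw [← heq']; exact mem_insert_self x Z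
    rw [mem_insert] at hx'
    rcases hx' with h | h
    · exact h
    · exact absurd h hxZ

/-- A negative set does not span: `E ∖ cl Z` is non-empty. -/
theorem one_le_card_sdiff_clF_of_mem_negTwo {F₀ Z : Finset α} (hZ : Z ∈ negTwo M F₀) :
    1 ≤ (gr M \ clF M Z).card := by
  rw [mem_negTwo] at hZ
  obtain ⟨hZs, hc⟩ := hZ
  have hZr : rk M Z = Z.card := (mem_biIndepAll.1 (mem_sepSets.1 hZs).1).2.1
  rw [Nat.one_le_iff_ne_zero, Ne, card_eq_zero, sdiff_eq_empty_iff_subset]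
  intro hcon
  have h1 : rk M (gr M) ≤ rk M (clF M Z) := rk_mono_fu hcon
  rw [rk_clF_eq_fu, hZr] at h1
  omega

/-- If every point outside `F₀` is a non-coloop, a negative set misses at least two points of the ground set. -/
theorem two_le_card_sdiff_clF_of_no_coloop {F₀ : Finset α}
    (hA : ∀ y ∈ gr M, y ∉ F₀ → rk M ((gr M).erase y) = rk M (gr M)) {Z : Finset α} (hZ : Z ∈ negTwo M F₀) :
    2 ≤ (gr M \ clF M Z).card := by
  have h1 := one_le_card_sdiff_clF_of_mem_negTwo hZ
  by_contra hcon
  have hone : (gr M \ clF M Z).card = 1 := by omega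
  obtain ⟨y, hy⟩ := card_eq_one.1 hone
  have hymem : y ∈ gr M \ clF M Z := by rw [hy]; exact mem_singleton_self y
  rw [mem_sdiff] at hymem
  obtain ⟨hZs, hc⟩ := mem_negTwo.1 hZ
  obtain ⟨hin, _⟩ := subset_clF_of_mem_sepSets_principal hZs
  have hZr : rk M Z = Z.card := (mem_biIndepAll.1 (mem_sepSets.1 hZs).1).2.1
  have hyF : y ∉ F₀ := fun h => hymem.2 (hin h)
  have hsub : (gr M).erase y ⊆ clF M Z := by
    intro z hz
    rw [mem_erase] at hz
    by_contra hzc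
    have : z ∈ gr M \ clF M Z := mem_sdiff.2 ⟨hz.2, hzc⟩
    rw [hy, mem_singleton] at this
    exact hz.1 this
  have h2 : rk M ((gr M).erase y) ≤ rk M (clF M Z) := rk_mono_fu hsub
  rw [rk_clF_eq_fu, hZr, hA y hymem.1 hyF] at h2
  omega

/-! ### The upper degree: a positive set lies above at most two negative sets -/

/-- **THE KEY LEMMA**: for a basis `B` of `M` and two distinct points `x₁, x₂ ∈ B` whose erasures both span `F₀`
(`rk F₀ + 2 = r`), every other point of `B` lies in `F₀`. -/
theorem mem_of_two_erase {F₀ : Finset α} (hF : IsFlatF M F₀) (hr : rk M F₀ + 2 = rk M (gr M))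
    {B : Finset α} (hBg : B ⊆ gr M) (hBr : rk M B = B.card) (hBc : B.card = rk M (gr M))
    {x₁ x₂ : α} (hx₁ : x₁ ∈ B) (hx₂ : x₂ ∈ B) (hne : x₁ ≠ x₂)
    (h₁ : F₀ ⊆ clF M (B.erase x₁)) (h₂ : F₀ ⊆ clF M (B.erase x₂)) {y : α} (hy : y ∈ B) (hy₁ : y ≠ x₁)
    (hy₂ : y ≠ x₂) : y ∈ F₀ := by
  by_contra hyF
  have hyg : y ∈ gr M := hBg hy
  have hx₂g : x₂ ∈ gr M := hBg hx₂
  have hF₀g : F₀ ⊆ gr M := hF.1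
  -- `rk (F₀ + y) = rk F₀ + 1`
  have hyF' : y ∉ clF M F₀ := by rw [hF.2]; exact hyF
  rw [mem_clF_iff_rk_insert_eq hyg hF₀g] at hyF'
  have hry : rk M (insert y F₀) = rk M F₀ + 1 := by
    have h1 := rk_insert_le (M := M) y F₀; have h2 := rk_mono_fu (M := M) (subset_insert y F₀); omega
  -- the closure of `B ∖ x₁` has rank `r − 1` and contains `F₀ + y` and `x₂`
  have he₁ : B.erase x₁ ⊆ gr M := (erase_subset _ _).trans hBg
  have hr₁ : rk M (clF M (B.erase x₁)) = rk M (gr M) - 1 := by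
    rw [rk_clF_eq_fu, rk_eq_card_of_subset_of_rk_eq_card (erase_subset x₁ B) hBr, card_erase_of_mem hx₁, hBc]
  have hyin : insert y F₀ ⊆ clF M (B.erase x₁) :=
    insert_subset (subset_clF_fu he₁ (mem_erase.2 ⟨hy₁, hy⟩)) h₁
  have hx₂in : x₂ ∈ clF M (B.erase x₁) := subset_clF_fu he₁ (mem_erase.2 ⟨hne.symm, hx₂⟩)
  -- hence `x₂ ∈ cl (F₀ + y)`
  have hyFg : insert y F₀ ⊆ gr M := insert_subset hyg hF₀g
  have hx₂cl : x₂ ∈ clF M (insert y F₀) := by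
    rw [mem_clF_iff_rk_insert_eq hx₂g hyFg]
    apply le_antisymm
    · have := rk_mono_fu (M := M) (insert_subset hx₂in hyin); rw [hr₁] at this; omega
    · exact rk_mono_fu (subset_insert _ _)
  -- but `F₀ + y ⊆ cl (B ∖ x₂)`, so `x₂ ∈ cl (B ∖ x₂)`: impossible for an independent `B`
  have he₂ : B.erase x₂ ⊆ gr M := (erase_subset _ _).trans hBg
  have hyin₂ : insert y F₀ ⊆ clF M (B.erase x₂) :=
    insert_subset (subset_clF_fu he₂ (mem_erase.2 ⟨hy₂, hy⟩)) h₂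
  have hcl₂ : clF M (insert y F₀) ⊆ clF M (B.erase x₂) := clF_subset_of_isFlatF (isFlatF_clF _) hyin₂
  exact notMem_clF_erase_of_rk_eq_card hx₂g hBg hBr hx₂ (hcl₂ hx₂cl)

/-- The erasures of a positive `B` whose closure contains `F₀`. -/
noncomputable def eraseSet (M : Matroid α) [M.Finite] (F₀ B : Finset α) : Finset α :=
  B.filter (fun x => F₀ ⊆ clF M (B.erase x))

/-- A positive set has at most two erasures spanning `F₀`. -/
theorem card_eraseSet_le_two {F₀ : Finset α} (hF : IsFlatF M F₀) (hr : rk M F₀ + 2 = rk M (gr M))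
    {B : Finset α} (hB : B ∈ posTwo M F₀) : (eraseSet M F₀ B).card ≤ 2 := by
  obtain ⟨hBs, hBc⟩ := mem_posTwo.1 hB
  obtain ⟨hBg, hBr, _⟩ := mem_biIndepAll.1 (mem_sepSets.1 hBs).1
  by_contra hcon
  have hcon' : 2 < (eraseSet M F₀ B).card := by omega
  obtain ⟨a, ha, b, hb, c, hc, hab, hac, hbc⟩ := two_lt_card.1 hcon'
  unfold eraseSet at ha hb hc
  rw [mem_filter] at ha hb hc
  have hcF : c ∈ F₀ := mem_of_two_erase hF hr hBg hBr hBc ha.1 hb.1 hab ha.2 hb.2 hc.1 hac.symm hbc.symm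
  exact notMem_clF_erase_of_rk_eq_card (hBg hc.1) hBg hBr hc.1 (hc.2 hcF)

/-- A negative set below a positive `B` is an erasure `B ∖ x` with `x ∈ eraseSet`. -/
theorem bipartiteBelow_subset_image {F₀ B : Finset α} (hB : B ∈ posTwo M F₀) :
    (negTwo M F₀).bipartiteBelow (fun (Z B : Finset α) => Z ⊆ B) B ⊆ (eraseSet M F₀ B).image (fun x => B.erase x) := by
  intro Z hZ
  rw [mem_bipartiteBelow] at hZ
  obtain ⟨hZn, hZB⟩ := hZ
  obtain ⟨hZs, hZc⟩ := mem_negTwo.1 hZn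
  obtain ⟨_, hBc⟩ := mem_posTwo.1 hB
  have hone : (B \ Z).card = 1 := by
    rw [card_sdiff_of_subset hZB]
    omega
  obtain ⟨x, hx⟩ := card_eq_one.1 hone
  have hxmem : x ∈ B \ Z := by rw [hx]; exact mem_singleton_self x
  rw [mem_sdiff] at hxmem
  have hZeq : B.erase x = Z := by
    ext z
    rw [mem_erase]
    constructor
    · rintro ⟨hzx, hzB⟩
      by_contra hzZ
      have : z ∈ B \ Z := mem_sdiff.2 ⟨hzB, hzZ⟩
      rw [hx, mem_singleton] at this
      exact hzx this
    · intro hz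
      exact ⟨fun h => hxmem.2 (h ▸ hz), hZB hz⟩
  rw [mem_image]
  refine ⟨x, ?_, hZeq⟩
  unfold eraseSet
  rw [mem_filter, hZeq]
  exact ⟨hxmem.1, (subset_clF_of_mem_sepSets_principal hZs).1⟩

/-- A positive set lies above at most two negative sets. -/
theorem card_bipartiteBelow_le_two {F₀ : Finset α} (hF : IsFlatF M F₀) (hr : rk M F₀ + 2 = rk M (gr M))
    {B : Finset α} (hB : B ∈ posTwo M F₀) :
    ((negTwo M F₀).bipartiteBelow (fun (Z B : Finset α) => Z ⊆ B) B).card ≤ 2 :=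
  (card_le_card (bipartiteBelow_subset_image hB)).trans (card_image_le.trans (card_eraseSet_le_two hF hr hB))

/-! ### The coloop case: at most one negative set below a positive one -/

/-- With a coloop `y ∉ F₀`, the erasure of a point `x₂ ≠ y` from a positive `B` is never a negative set. -/
theorem erase_notMem_negTwo_of_coloop {F₀ : Finset α} (hF : IsFlatF M F₀) (hr : rk M F₀ + 2 = rk M (gr M))
    (hN : (gr M).card + 2 = 2 * rk M (gr M)) {y : α} (hyF : y ∉ F₀)
    (hco : rk M ((gr M).erase y) + 1 = rk M (gr M)) {B : Finset α} (hB : B ∈ posTwo M F₀) {x₂ : α} (hx₂ : x₂ ∈ B)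
    (hx₂y : x₂ ≠ y) : B.erase x₂ ∉ negTwo M F₀ := by
  intro hZ
  obtain ⟨hZs, hZc⟩ := mem_negTwo.1 hZ
  obtain ⟨_, hout⟩ := subset_clF_of_mem_sepSets_principal hZs
  obtain ⟨hBs, hBc⟩ := mem_posTwo.1 hB
  obtain ⟨hBg, hBr, _⟩ := mem_biIndepAll.1 (mem_sepSets.1 hBs).1
  obtain ⟨_, _, hZcr⟩ := mem_biIndepAll.1 (mem_sepSets.1 hZs).1
  -- `y ∈ B` (a coloop lies in every basis)
  have hyB : y ∈ B := by
    by_contra hyB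
    have h1 : B ⊆ (gr M).erase y := fun z hz => mem_erase.2 ⟨fun h => hyB (h ▸ hz), hBg hz⟩
    have h2 := rk_mono_fu (M := M) h1; rw [hBr, hBc] at h2; omega
  -- `E ∖ (B ∖ x₂)` and `F₀` lie in the hyperplane `E ∖ y`, which has the rank of `E ∖ (B ∖ x₂)`
  have hcard : (gr M \ B.erase x₂).card + 1 = rk M (gr M) := by
    have h1 : (B.erase x₂).card + (gr M \ B.erase x₂).card = (gr M).card := by
      have hsub : B.erase x₂ ⊆ gr M := (erase_subset _ _).trans hBg
      rw [card_sdiff_of_subset hsub]; have := card_le_card hsub; omega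
    rw [card_erase_of_mem hx₂, hBc] at h1; omega
  have hsub : gr M \ B.erase x₂ ⊆ (gr M).erase y := by
    intro z hz
    rw [mem_sdiff] at hz
    rw [mem_erase]
    refine ⟨fun h => hz.2 ?_, hz.1⟩
    rw [h]
    exact mem_erase.2 ⟨hx₂y.symm, hyB⟩
  apply hout
  intro z hz
  have hzg : z ∈ gr M := hF.1 hz
  rw [mem_clF_iff_rk_insert_eq hzg sdiff_subset]
  apply le_antisymm
  · have h1 : insert z (gr M \ B.erase x₂) ⊆ (gr M).erase y :=
      insert_subset (mem_erase.2 ⟨fun h => hyF (h ▸ hz), hzg⟩) hsub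
    have h2 := rk_mono_fu (M := M) h1
    rw [hZcr]
    omega
  · exact rk_mono_fu (subset_insert _ _)

/-- With a coloop `y ∉ F₀`, a positive set lies above at most one negative set. -/
theorem card_bipartiteBelow_le_one_of_coloop {F₀ : Finset α} (hF : IsFlatF M F₀)
    (hr : rk M F₀ + 2 = rk M (gr M)) (hN : (gr M).card + 2 = 2 * rk M (gr M)) {y : α}
    (hyF : y ∉ F₀) (hco : rk M ((gr M).erase y) + 1 = rk M (gr M)) {B : Finset α} (hB : B ∈ posTwo M F₀) :
    ((negTwo M F₀).bipartiteBelow (fun (Z B : Finset α) => Z ⊆ B) B).card ≤ 1 := by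
  rw [card_le_one]
  intro Z₁ hZ₁ Z₂ hZ₂
  have hsub := bipartiteBelow_subset_image hB
  obtain ⟨x₁, hx₁, rfl⟩ := mem_image.1 (hsub hZ₁)
  obtain ⟨x₂, hx₂, rfl⟩ := mem_image.1 (hsub hZ₂)
  unfold eraseSet at hx₁ hx₂
  rw [mem_filter] at hx₁ hx₂
  by_cases hx : x₁ = x₂
  · rw [hx]
  · exfalso
    obtain ⟨hBs, hBc⟩ := mem_posTwo.1 hB
    obtain ⟨hBg, hBr, _⟩ := mem_biIndepAll.1 (mem_sepSets.1 hBs).1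
    have hZ₁n : B.erase x₁ ∈ negTwo M F₀ := ((mem_bipartiteBelow _).1 hZ₁).1
    have hZ₂n : B.erase x₂ ∈ negTwo M F₀ := ((mem_bipartiteBelow _).1 hZ₂).1
    by_cases hy₁ : y = x₁
    · exact erase_notMem_negTwo_of_coloop hF hr hN hyF hco hB hx₂.1 (fun h => hx (hy₁.symm.trans h.symm)) hZ₂n
    · by_cases hy₂ : y = x₂
      · exact erase_notMem_negTwo_of_coloop hF hr hN hyF hco hB hx₁.1 (fun h => hx (h.trans hy₂)) hZ₁n
      · -- `y ∈ B` and `y ∉ {x₁, x₂}`, so `y ∈ F₀` by the key lemma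
        have hyB : y ∈ B := by
          by_contra hyB
          have h1 : B ⊆ (gr M).erase y := fun z hz => mem_erase.2 ⟨fun h => hyB (h ▸ hz), hBg hz⟩
          have h2 := rk_mono_fu (M := M) h1; rw [hBr, hBc] at h2; omega
        exact hyF (mem_of_two_erase hF hr hBg hBr hBc hx₁.1 hx₂.1 hx hx₁.2 hx₂.2 hyB hy₁ hy₂)

/-! ### The double counting -/

/-- **THE NEGATIVE TERMS ARE AT MOST THE POSITIVE ONES** in the corank-two regime. -/
theorem card_negTwo_le_card_posTwo {F₀ : Finset α} (hF : IsFlatF M F₀) (hr : rk M F₀ + 2 = rk M (gr M))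
    (hN : (gr M).card + 2 = 2 * rk M (gr M)) : (negTwo M F₀).card ≤ (posTwo M F₀).card := by
  by_cases hA : ∃ y ∈ gr M, y ∉ F₀ ∧ rk M ((gr M).erase y) + 1 = rk M (gr M)
  · obtain ⟨y, _, hyF, hco⟩ := hA
    have h := card_mul_le_card_mul (fun (Z B : Finset α) => Z ⊆ B) (s := negTwo M F₀) (t := posTwo M F₀)
      (m := 1) (n := 1)
      (fun Z hZ => (one_le_card_sdiff_clF_of_mem_negTwo hZ).trans (card_sdiff_clF_le_card_bipartiteAbove hZ))
      (fun B hB => card_bipartiteBelow_le_one_of_coloop hF hr hN hyF hco hB)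
    omega
  · have hA' : ∀ y ∈ gr M, y ∉ F₀ → rk M ((gr M).erase y) = rk M (gr M) := by
      intro y hy hyF
      have h1 : rk M ((gr M).erase y) ≤ rk M (gr M) := rk_mono_fu (erase_subset _ _)
      have h2 : rk M (gr M) ≤ rk M ((gr M).erase y) + 1 := by
        have := rk_insert_le (M := M) y ((gr M).erase y); rwa [insert_erase hy] at this
      by_contra hne
      exact hA ⟨y, hy, hyF, by omega⟩
    have h := card_mul_le_card_mul (fun (Z B : Finset α) => Z ⊆ B) (s := negTwo M F₀) (t := posTwo M F₀)
      (m := 2) (n := 2)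
      (fun Z hZ => (two_le_card_sdiff_clF_of_no_coloop hA' hZ).trans (card_sdiff_clF_le_card_bipartiteAbove hZ))
      (fun B hB => card_bipartiteBelow_le_two hF hr hB)
    omega

/-- **(G) AT THE PRINCIPAL UP-SET OF A FLAT OF CORANK TWO ON `2r − 2` POINTS**: the signed sum is non-negative. -/
theorem sum_sepSets_principal_corank_two_nonneg {F₀ : Finset α} (hF : IsFlatF M F₀)
    (hr : rk M F₀ + 2 = rk M (gr M)) (hN : (gr M).card + 2 = 2 * rk M (gr M)) :
    0 ≤ ∑ Z ∈ sepSets M (principalUp M F₀), (2 * (Z.card : ℤ) - (gr M).card - 1) := by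
  have h1 : ∑ Z ∈ sepSets M (principalUp M F₀), (2 * (Z.card : ℤ) - (gr M).card - 1) =
      ∑ Z ∈ sepSets M (principalUp M F₀),
        ((if Z ∈ posTwo M F₀ then 1 else 0 : ℤ) - (if Z ∈ negTwo M F₀ then 1 else 0)) :=
    sum_congr rfl (fun Z hZ => term_eq_of_mem_sepSets_corank_two hF hr hN hZ)
  have hP : (sepSets M (principalUp M F₀)).filter (fun Z => Z ∈ posTwo M F₀) = posTwo M F₀ := by
    ext Z
    rw [mem_filter]
    exact ⟨fun h => h.2, fun h => ⟨(mem_posTwo.1 h).1, h⟩⟩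
  have hN' : (sepSets M (principalUp M F₀)).filter (fun Z => Z ∈ negTwo M F₀) = negTwo M F₀ := by
    ext Z
    rw [mem_filter]
    exact ⟨fun h => h.2, fun h => ⟨(mem_negTwo.1 h).1, h⟩⟩
  rw [h1, sum_sub_distrib, sum_boole, sum_boole, hP, hN']
  have h2 := card_negTwo_le_card_posTwo hF hr hN
  have h3 : ((negTwo M F₀).card : ℤ) ≤ (posTwo M F₀).card := by exact_mod_cast h2
  linarith

end PercRepro.Cogirth
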